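import Literature.AlgebraicGeometry.ShimuraVarieties.Deligne1979ComplexPoints
import Literature.AlgebraicGeometry.HodgeTheory.SmoothProjectiveComponents
import Literature.AlgebraicGeometry.HodgeTheory.TopDegreeClasses
import HarnessLib

/-!
# The components of a smooth projective complex model of `Sh_K(ℂ)`: finiteness of `Ξ_K` and the coproduct

Sequel to `ShimuraSetModelComponents` (Deligne 1979, §2.1.2–2.1.3 read on an algebraic model `X` of
`Sh_K(ℂ) = U(H)(L⁺) \ [𝔹² × U(H)(𝔸_{L⁺,f}) / K]`, `X` smooth of relative dimension `d` over `ℂ` and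
projective, `e : X(ℂ) ≃ₜ Sh_K(ℂ)`).  Two conclusions are added to the component decomposition
`(ι_q : E_q ⟶ X)_{q ∈ Ξ_K}`, using the tree's `HodgeTheory.exists_components_isSmoothProjective_isColimit`:

* `Ξ_K = U(H)(L⁺) \ U(H)(𝔸_{L⁺,f}) / K` is FINITE — it is in bijection with the irreducible components of the
  Noetherian scheme `X` (so a model forces finiteness with no anisotropy hypothesis);
* the cofan `(ι_q)_q` is a COLIMIT in `SchemeOver ℂ`: `X ≅ ∐_{q ∈ Ξ_K} E_q` as `ℂ`-schemes — the scheme-level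
  form of Deligne's "disjoint sum indexed by `G(ℚ) \ G(𝔸^f)/K`".

Statements: `Deligne1979.exists_components_indexed_isColimit`,
`Deligne1979.exists_components_homeomorph_ballQuotient_isColimit`.  THEOREMS ONLY; no definition, no named fact.
Use (cells pub-hodgecm / pub-hodgecm2, TEAM hComp (U3)): the interface «finitely many open-closed `X_c`, each
`IsSmoothProjective`, cofan colimit, `X_c(ℂ)` = connected components» for `X = X_K ⊗_{E,ι₁} ℂ`.

## References
* [Deligne1979ShimuraVarieties] P. Deligne, *Variétés de Shimura*, Proc. Symp. Pure Math. 33.2 (1979), §2.1.2–2.1.3.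
* [Milne2005ShimuraVarieties] J. S. Milne, *Introduction to Shimura varieties* (2005), Lemma 5.13.
-/

set_option autoImplicit false

noncomputable section

open Function MulAction Topology NumberField CategoryTheory CategoryTheory.Limits AlgebraicGeometry
open Literature.AlgebraicGeometry.Motives
open Literature.AlgebraicTopology.SingularHomology (IsClopenPartition)
open Literature.NumberTheory.Automorphic Literature.NumberTheory.Automorphic.UnitaryGroup
open Literature.NumberTheory.Automorphic.ShimuraDissection
open Literature.Geometry.ComplexHyperbolic Literature.Geometry.ComplexHyperbolic.BallModel

namespace Literature.AlgebraicGeometry.ShimuraVarieties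

/-! ### Point-set lemmas (private helpers, as in `ShimuraSetModelComponents`) -/

/-- A homeomorphism carries connected components to connected components. [folklore] -/
private theorem image_connectedComponent_homeomorph' {X Y : Type*} [TopologicalSpace X]
    [TopologicalSpace Y] (e : X ≃ₜ Y) (x : X) : e '' connectedComponent x = connectedComponent (e x) := by
  refine Set.Subset.antisymm (e.continuous.image_connectedComponent_subset x) ?_
  have h := e.symm.continuous.image_connectedComponent_subset (e x)
  rw [e.symm_apply_apply] at h
  calc connectedComponent (e x) = e '' (e.symm '' connectedComponent (e x)) :=
        (e.image_symm_image _).symm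
    _ ⊆ e '' connectedComponent x := Set.image_mono h

/-- A clopen preconnected set containing `x` is the connected component of `x`. [folklore] -/
private theorem eq_connectedComponent_of_isClopen' {X : Type*} [TopologicalSpace X] {S : Set X}
    (hS : IsClopen S) (hc : IsPreconnected S) {x : X} (hx : x ∈ S) : S = connectedComponent x :=
  Set.Subset.antisymm (hc.subset_connectedComponent hx) (hS.connectedComponent_subset hx)

/-- The pieces of a clopen partition are closed. [folklore] -/
private theorem isClosed_of_isClopenPartition' {Z : Type*} [TopologicalSpace Z] {ι : Type*} {A : ι → Set Z}
    (h : IsClopenPartition A) (k : ι) : IsClosed (A k) := by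
  rw [← isOpen_compl_iff, isOpen_iff_forall_mem_open]
  intro z hz
  obtain ⟨j, hj⟩ := h.exists_mem z
  have hjk : j ≠ k := fun hjk => hz (hjk ▸ hj)
  exact ⟨A j, fun w hw hwk => Set.disjoint_left.mp (h.disjoint hjk) hw hwk, h.isOpen j, hj⟩

namespace Deligne1979

variable (L : Type) [Field L] [NumberField L] [IsCMField L] (H : Matrix (Fin 3) (Fin 3) L)
  (τ : L →+* ℂ) (T : GL (Fin 3) ℂ) (hT : formCongr (starRingEnd ℂ) T (H.map τ) = BallModel.J)
  (K : Subgroup (finAdelic (↥(maximalRealSubfield L)) L (IsCMField.complexConj L) 3 H))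

/-! ### Components indexed by `Ξ_K`: finiteness and the coproduct -/

/-- **The components of a smooth projective complex model of `Sh_K(ℂ)`: indexed by `Ξ_K`, finitely many,
and `X` is their COPRODUCT.**  Let `X` be smooth of relative dimension `d` over `ℂ` and projective,
`e : X(ℂ) ≃ₜ Sh_K(ℂ)` a homeomorphism (`K` open) and `g_q` representatives of
`Ξ_K = U(H)(L⁺) \ U(H)(𝔸_{L⁺,f}) / K`.  Then there are open-and-closed subschemes `E_q ↪ X`, `q ∈ Ξ_K`, each a
smooth projective geometrically irreducible `d`-fold, whose complex points form a clopen partition of `X(ℂ)`,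
with `e(E_q(ℂ)) = {[z, g_q K] : z ∈ 𝔹²}`; moreover `Ξ_K` is FINITE (in bijection with the irreducible
components of the Noetherian scheme `X` — no anisotropy hypothesis needed) and the cofan
`(ι_q : E_q ⟶ X)_{q ∈ Ξ_K}` is a COLIMIT in `SchemeOver ℂ`, `X ≅ ∐_q E_q` (Deligne 1979 §2.1.2 "disjoint sum
indexed by `G(ℚ) \ G(𝔸^f)/K` of the `Γ'_g \ X⁺`", read on the model: the `E_q` are the irreducible = connected
components of `X`, `HodgeTheory.exists_components_isSmoothProjective_isColimit`, re-indexed through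
`π₀(Sh_K(ℂ)) ≃ Ξ_K`, `connectedComponents_equiv_index`; the colimit is transported along the re-indexing by
`Cofan.isColimitEquivOfEquiv`). [cite: Deligne1979ShimuraVarieties, §2.1.2–2.1.3] -/
theorem exists_components_indexed_isColimit {X : SchemeOver ℂ} {d : ℕ} [SmoothOfRelativeDimension d X.hom]
    (hX : IsProjectiveOver X)
    (hK : IsOpen (K : Set (finAdelic (↥(maximalRealSubfield L)) L (IsCMField.complexConj L) 3 H)))
    (e : ComplexPoints X ≃ₜ ShimuraSet L H τ T hT K)
    (g : orbitRel.Quotient (rational (↥(maximalRealSubfield L)) L (IsCMField.complexConj L) 3 H)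
          (CosetSpace (rationalToFinAdelic (↥(maximalRealSubfield L)) L (IsCMField.complexConj L) 3 H)
            K) →
        finAdelic (↥(maximalRealSubfield L)) L (IsCMField.complexConj L) 3 H)
    (hg : ∀ q, Quotient.mk'' (CosetSpace.pt (rationalToFinAdelic _ L _ 3 H) K (g q)) = q) :
    ∃ (E : orbitRel.Quotient (rational (↥(maximalRealSubfield L)) L (IsCMField.complexConj L) 3 H)
          (CosetSpace (rationalToFinAdelic (↥(maximalRealSubfield L)) L (IsCMField.complexConj L) 3 H)
            K) → SchemeOver ℂ)
      (ι : ∀ q, E q ⟶ X),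
      (∀ q, IsSmoothProjective d (E q)) ∧ (∀ q, IsOpenImmersion (ι q).left) ∧
        (∀ q, IsClosedImmersion (ι q).left) ∧
        IsClopenPartition (fun q => Set.range (AlgPoints.map (L := ℂ) (ι q))) ∧
        (∀ q, e '' Set.range (AlgPoints.map (L := ℂ) (ι q)) =
          Set.range (fun z : Ball => ShimuraSet.mk L H τ T hT K z (g q))) ∧
        Finite (orbitRel.Quotient (rational (↥(maximalRealSubfield L)) L (IsCMField.complexConj L) 3 H)
          (CosetSpace (rationalToFinAdelic (↥(maximalRealSubfield L)) L (IsCMField.complexConj L) 3 H)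
            K)) ∧
        Nonempty (IsColimit (Cofan.mk X ι)) := by
  classical
  obtain ⟨C, hCfin, E, ι, hE, hopen, hclosed, hA, ⟨hcol⟩⟩ :=
    Literature.AlgebraicGeometry.HodgeTheory.exists_components_isSmoothProjective_isColimit (d := d) hX
  obtain ⟨π, hπ⟩ := connectedComponents_equiv_index L H τ T hT K hK
  -- the pieces `S c = E_c(ℂ) ⊆ X(ℂ)`: non-empty, connected, clopen
  haveI hconn : ∀ c, ConnectedSpace (ComplexPoints (E c)) := fun c =>
    Literature.AlgebraicGeometry.HodgeTheory.connectedSpace_complexPoints (hE c)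
  let P : ∀ c, ComplexPoints (E c) := fun c => Classical.arbitrary _
  set S : C → Set (ComplexPoints X) := fun c => Set.range (AlgPoints.map (L := ℂ) (ι c)) with hS_def
  have hSconn : ∀ c, IsConnected (S c) := fun c =>
    isConnected_range (AlgPoints.continuous_map (L := ℂ) (ι c))
  have hSclopen : ∀ c, IsClopen (S c) := fun c =>
    ⟨isClosed_of_isClopenPartition' hA c, hA.isOpen c⟩
  have hPS : ∀ c, AlgPoints.map (L := ℂ) (ι c) (P c) ∈ S c := fun c => ⟨P c, rfl⟩
  -- `e(S c)` is the connected component of `e (ι_c (P c))`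
  have hkey : ∀ c, e '' S c = connectedComponent (e (AlgPoints.map (L := ℂ) (ι c) (P c))) := fun c => by
    rw [eq_connectedComponent_of_isClopen' (hSclopen c) (hSconn c).isPreconnected (hPS c),
      image_connectedComponent_homeomorph']
  -- the index of a component
  let f : C → orbitRel.Quotient (rational (↥(maximalRealSubfield L)) L (IsCMField.complexConj L) 3 H)
      (CosetSpace (rationalToFinAdelic (↥(maximalRealSubfield L)) L (IsCMField.complexConj L) 3 H) K) :=
    fun c => π (ConnectedComponents.mk (e (AlgPoints.map (L := ℂ) (ι c) (P c))))
  have hf_inj : Function.Injective f := by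
    intro c₁ c₂ h
    have h' := π.injective h
    rw [ConnectedComponents.coe_eq_coe] at h'
    have hS12 : S c₁ = S c₂ := e.injective.image_injective (by rw [hkey, hkey, h'])
    have hmem : AlgPoints.map (L := ℂ) (ι c₁) (P c₁) ∈ S c₂ := hS12 ▸ hPS c₁
    exact hA.eq_of_mem (hPS c₁) hmem
  have hf_val : ∀ c q, f c = q ↔
      connectedComponent (e (AlgPoints.map (L := ℂ) (ι c) (P c))) =
        connectedComponent (ShimuraSet.mk L H τ T hT K x₀ (g q)) := by
    intro c q
    constructor
    · intro h
      have h1 : π (ConnectedComponents.mk (e (AlgPoints.map (L := ℂ) (ι c) (P c)))) =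
          π (ConnectedComponents.mk (ShimuraSet.mk L H τ T hT K x₀ (g q))) := by
        rw [hπ, hg]; exact h
      have h2 := π.injective h1
      rwa [ConnectedComponents.coe_eq_coe] at h2
    · intro h
      have h2 : (ConnectedComponents.mk (e (AlgPoints.map (L := ℂ) (ι c) (P c))) :
          ConnectedComponents (ShimuraSet L H τ T hT K)) =
          ConnectedComponents.mk (ShimuraSet.mk L H τ T hT K x₀ (g q)) :=
        ConnectedComponents.coe_eq_coe.mpr h
      change π _ = q
      rw [h2, hπ, hg]
  have hf_surj : Function.Surjective f := by
    intro q
    obtain ⟨c, hc⟩ := hA.exists_mem (e.symm (ShimuraSet.mk L H τ T hT K x₀ (g q)))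
    refine ⟨c, (hf_val c q).mpr (connectedComponent_eq ?_)⟩
    rw [← hkey c]
    exact ⟨_, hc, e.apply_symm_apply _⟩
  let σ := Equiv.ofBijective f ⟨hf_inj, hf_surj⟩
  refine ⟨fun q => E (σ.symm q), fun q => ι (σ.symm q), fun q => hE _, fun q => hopen _,
    fun q => hclosed _, ⟨fun q => hA.isOpen _, fun q₁ q₂ hne => hA.disjoint
      (fun h => hne (σ.symm.injective h)), fun z => ?_⟩, fun q => ?_, Finite.of_equiv C σ,
    ⟨(Cofan.isColimitEquivOfEquiv σ.symm (Cofan.mk X ι)) hcol⟩⟩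
  · obtain ⟨c, hc⟩ := hA.exists_mem z
    refine ⟨σ c, ?_⟩
    have hσ : σ.symm (σ c) = c := σ.symm_apply_apply c
    change z ∈ S (σ.symm (σ c))
    rw [hσ]
    exact hc
  · have hq : f (σ.symm q) = q := Equiv.ofBijective_apply_symm_apply f ⟨hf_inj, hf_surj⟩ q
    change e '' S (σ.symm q) = _
    rw [hkey, (hf_val _ q).mp hq, connectedComponent_mk L H τ T hT K hK x₀ (g q)]

/-! ### With the homeomorphisms to the ball quotients -/

/-- **Components of a model: homeomorphisms to the ball quotients, finiteness of `Ξ_K`, and the coproduct.**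
In the situation of `exists_components_indexed_isColimit` one can moreover choose homeomorphisms
`φ_q : E_q(ℂ) ≃ₜ Δ(Γ_H(g_q K g_q⁻¹)) \ 𝔹²` with `ι_q(φ_q⁻¹[z]) = e⁻¹[z, g_q K]` for all `z ∈ 𝔹²`
(Deligne 1979 §2.1.2: the summand of the disjoint sum over the double coset of `g_q` is `Γ'_{g_q} \ X⁺`,
`Γ'_g = gKg⁻¹ ∩ G(ℚ)`; the tree's dissection `UnitaryGroup.shimuraSetHomeomorph` restricted to one summand,
composed with `e` and the open embedding `E_q(ℂ) ↪ X(ℂ)`), keeping `Finite Ξ_K` and the colimit.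
[cite: Deligne1979ShimuraVarieties, §2.1.2] [cite: Milne2005ShimuraVarieties, Lemma 5.13] -/
theorem exists_components_homeomorph_ballQuotient_isColimit {X : SchemeOver ℂ} {d : ℕ}
    [SmoothOfRelativeDimension d X.hom] (hX : IsProjectiveOver X)
    (hK : IsOpen (K : Set (finAdelic (↥(maximalRealSubfield L)) L (IsCMField.complexConj L) 3 H)))
    (e : ComplexPoints X ≃ₜ ShimuraSet L H τ T hT K)
    (g : orbitRel.Quotient (rational (↥(maximalRealSubfield L)) L (IsCMField.complexConj L) 3 H)
          (CosetSpace (rationalToFinAdelic (↥(maximalRealSubfield L)) L (IsCMField.complexConj L) 3 H)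
            K) →
        finAdelic (↥(maximalRealSubfield L)) L (IsCMField.complexConj L) 3 H)
    (hg : ∀ q, Quotient.mk'' (CosetSpace.pt (rationalToFinAdelic _ L _ 3 H) K (g q)) = q) :
    ∃ (E : orbitRel.Quotient (rational (↥(maximalRealSubfield L)) L (IsCMField.complexConj L) 3 H)
          (CosetSpace (rationalToFinAdelic (↥(maximalRealSubfield L)) L (IsCMField.complexConj L) 3 H)
            K) → SchemeOver ℂ)
      (ι : ∀ q, E q ⟶ X)
      (φ : ∀ q, ComplexPoints (E q) ≃ₜ
        orbitRel.Quotient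
          (archImageU21 L H τ T hT
            (arithmeticLevel (↥(maximalRealSubfield L)) L (IsCMField.complexConj L) 3 H
              (K.map (MulAut.conj (g q)).toMonoidHom)))
          Ball),
      (∀ q, IsSmoothProjective d (E q)) ∧ (∀ q, IsOpenImmersion (ι q).left) ∧
        (∀ q, IsClosedImmersion (ι q).left) ∧
        IsClopenPartition (fun q => Set.range (AlgPoints.map (L := ℂ) (ι q))) ∧
        (∀ q, e '' Set.range (AlgPoints.map (L := ℂ) (ι q)) =
          Set.range (fun z : Ball => ShimuraSet.mk L H τ T hT K z (g q))) ∧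
        (∀ q (z : Ball), AlgPoints.map (L := ℂ) (ι q) ((φ q).symm (Quotient.mk'' z)) =
          e.symm (ShimuraSet.mk L H τ T hT K z (g q))) ∧
        Finite (orbitRel.Quotient (rational (↥(maximalRealSubfield L)) L (IsCMField.complexConj L) 3 H)
          (CosetSpace (rationalToFinAdelic (↥(maximalRealSubfield L)) L (IsCMField.complexConj L) 3 H)
            K)) ∧
        Nonempty (IsColimit (Cofan.mk X ι)) := by
  classical
  obtain ⟨E, ι, hE, hopen, hclosed, hA, himg, hfin, hcol⟩ :=
    exists_components_indexed_isColimit L H τ T hT K (d := d) hX hK e g hg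
  -- the dissection `Φ : Sh_K(ℂ) ≃ₜ Σ q, Δ(Γ_H(g_q K g_q⁻¹)) \ 𝔹²`
  let Φ := shimuraSetHomeomorph L H τ T hT K hK hg
  -- the summand inclusions `j_q : Δ(Γ_H(g_q K g_q⁻¹)) \ 𝔹² → Sh_K(ℂ)`, `[z] ↦ [z, g_q K]`, are embeddings onto the pieces
  let BQ := fun q : orbitRel.Quotient (rational (↥(maximalRealSubfield L)) L (IsCMField.complexConj L) 3 H)
      (CosetSpace (rationalToFinAdelic (↥(maximalRealSubfield L)) L (IsCMField.complexConj L) 3 H) K) =>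
    orbitRel.Quotient
      (archImageU21 L H τ T hT
        (arithmeticLevel (↥(maximalRealSubfield L)) L (IsCMField.complexConj L) 3 H
          (K.map (MulAut.conj (g q)).toMonoidHom)))
      Ball
  let j : ∀ q, BQ q → ShimuraSet L H τ T hT K := fun q w => Φ.symm ⟨q, w⟩
  have hj : ∀ q, IsEmbedding (j q) := fun q =>
    Φ.symm.isEmbedding.comp (IsOpenEmbedding.sigmaMk (σ := BQ) (i := q)).isEmbedding
  have hjrange : ∀ q, Set.range (fun z : Ball => ShimuraSet.mk L H τ T hT K z (g q)) = Set.range (j q) := by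
    intro q
    ext c
    constructor
    · rintro ⟨z, rfl⟩
      exact ⟨Quotient.mk'' z, shimuraSetHomeomorph_symm_apply_mk L H τ T hT K hK hg q z⟩
    · rintro ⟨w, rfl⟩
      induction w using Quotient.inductionOn' with | h z => ?_
      exact ⟨z, (shimuraSetHomeomorph_symm_apply_mk L H τ T hT K hK hg q z).symm⟩
  -- `E_q(ℂ) ≃ₜ ι_q(E_q(ℂ)) ≃ₜ e(ι_q(E_q(ℂ))) = piece_q = range j_q ≃ₜ Δ(Γ_H(g_q K g_q⁻¹)) \ 𝔹²`
  have hemb : ∀ q, IsEmbedding (AlgPoints.map (L := ℂ) (ι q)) := fun q =>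
    haveI := hopen q
    (AlgPoints.isOpenEmbedding_map_holds (L := ℂ) (ι q)).isEmbedding
  let h1 : ∀ q, ComplexPoints (E q) ≃ₜ Set.range (AlgPoints.map (L := ℂ) (ι q)) := fun q =>
    (hemb q).toHomeomorph
  let ψ : ∀ q, ComplexPoints (E q) ≃ₜ Set.range (j q) := fun q =>
    (h1 q).trans <| (e.image _).trans <| (Homeomorph.setCongr (himg q)).trans
      (Homeomorph.setCongr (hjrange q))
  have hψ : ∀ q (x : ComplexPoints (E q)), ((ψ q x) : ShimuraSet L H τ T hT K) =
      e (AlgPoints.map (L := ℂ) (ι q) x) := fun q x => by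
    simp only [ψ, h1, Homeomorph.trans_apply, Homeomorph.setCongr, Homeomorph.homeomorph_mk_coe,
      Equiv.setCongr_apply, Homeomorph.image_apply_coe, IsEmbedding.toHomeomorph_apply_coe]
  let φ : ∀ q, ComplexPoints (E q) ≃ₜ BQ q := fun q => (ψ q).trans (hj q).toHomeomorph.symm
  have hφ : ∀ q (x : ComplexPoints (E q)), j q (φ q x) = e (AlgPoints.map (L := ℂ) (ι q) x) := by
    intro q x
    have h := congrArg Subtype.val ((hj q).toHomeomorph.apply_symm_apply (ψ q x))
    rw [IsEmbedding.toHomeomorph_apply_coe] at h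
    rw [← hψ q x]
    exact h
  refine ⟨E, ι, φ, hE, hopen, hclosed, hA, himg, fun q z => ?_, hfin, hcol⟩
  -- `ι_q (φ_q⁻¹ [z]) = e⁻¹ (j_q [z]) = e⁻¹ [z, g_q K]`
  have h := hφ q ((φ q).symm (Quotient.mk'' z))
  rw [Homeomorph.apply_symm_apply] at h
  apply e.injective
  rw [e.apply_symm_apply, ← h]
  exact shimuraSetHomeomorph_symm_apply_mk L H τ T hT K hK hg q z

end Deligne1979

end Literature.AlgebraicGeometry.ShimuraVarieties

end
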